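import Literature.AlgebraicGeometry.Resolution.BaseTreeFiniteKonig
import Mathlib.RingTheory.UniqueFactorizationDomain.Multiplicity
import Mathlib.Data.Set.Card
import HarnessLib

/-!
# [OURS · L1 W4.2] σ-LAYER, TAME-LOW row T-L2, FILE 1a — `Corridor3SigmaTameLowCoeff`: the COEFFICIENT-IDEAL DATUM on the contact surface germ
# `𝒪_{H₂,x}` (a two-dimensional regular local ring READ IN ITS FRACTION FIELD `K`, the shape of `Literature…Resolution.idealBaseTree`), the
# LIPMAN FACTORISATION `𝔞 = 𝔪on · (g) · 𝔞♮` (PROVED), and the BASE-POINT SOCKET `(idealBaseTree R 𝔞♮).ncard` for row T-L3 (Zariski finiteness =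
# tree theorem `finite_idealBaseTree_of_isRegularLocalRing`, an IMPORT)
# (crux chain w42 `SigmaMaxModifications` stmt-ResolutionOfSingularities-18506 / conjunct `SigmaMaxModificationsCorridor3` stmt-ResolutionOfSingularities-19249;
# res-L1-w42-plan-1 RULING v3.14-48 (PD)(iii)/(PF) row T-L2 + DESK WORD 2026-08-27T18:33:36Z sockets (s1)(s2) + item (c); seat res-L1-type-o2 g9 =
# «res-type-067/068 SUCCESSOR» by res-plan-2 DEAL #44; `--supports stmt-ResolutionOfSingularities-19249 --as helper`, counted 0)

HONEST FRAMING. OURS bookkeeping for the TAME-LOW sub-tier of the W4.2 σ-policy (cell res-hironaka). NOTHING here is a statement of H. Hironaka's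
manuscript [Hironaka2017] nor of Cossart–Jannsen–Saito; the factorisation of §1 is classical commutative algebra (Lipman 1969 p. 51 «an ideal is uniquely
`P·I`, `P` principal, `I` 𝔪-primary» in a two-dimensional regular local ring; Zariski–Samuel II App. 5), PROVED here over Mathlib and the tree; no named
fact is introduced, no axiom. AI-typed; AI review is weaker than expert review.

## Setting (RULING v3.14-47 SUPPLEMENT (MD′) (TL1)–(TL4), -48 (PD))

At a TAME-LOW point `x` (value `(ν, S₀)`, `1 ≤ S₀ < m`) the ideal on the maximal-contact threefold germ `H` is `I = M·N`, `ord_x N = S₀`;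
`J := I^{S₀} + N^{m}`, threshold `c := m·S₀`; res-D-pv-060's row T-L1 supplies the contact element `z` (`ord_x z = 1`) and `H₂ := V(z) ⊂ H`, a regular
SURFACE germ; `𝔞 := Coeff_{H₂}(J) ⊂ R := 𝒪_{H₂,x}`, a two-dimensional regular local ring. THIS FILE starts at `R` and `𝔞`: it does not see `H`, `J`, `z`
or Hasse operators (those, the equivalence «`Sing(J,c) ∩ H₂`-nbhd `= Sing(𝔞, ·)`» and the transform laws are READING AXIOMS of FILE 1b / row T-L6).

## Contents (namespace `…Theorems.SigmaMaxModificationsCorridor3.Sigma.TameLow`)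

* §1 **LIPMAN FACTORISATION, PROVED** over any Noetherian local domain `A` with a finite family of NON-UNIT «trace» elements `u_i` (`i ∈ s`):
  `exists_eq_prod_pow_mul_forall_not_dvd` (a non-zero `G` is `(∏ u_i^{a_i}) · g` with `u_i ∤ g` for every `i` and `a = 0` off `s` — maximal powers
  extracted one trace at a time, `WfDvdMonoid.max_power_factor'`), and **`exists_lipmanFactorisation`**: every ideal `𝔞 ≠ 0` of `A` is
  `(∏ u_i^{a_i}) · (g) · 𝔞♮` with `g ≠ 0`, `u_i ∤ g`, and `𝔞♮` contained in NO proper principal ideal (the tree's gcd removal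
  `exists_eq_span_singleton_mul_forall_not_le`, BaseTreeFinite.lean); in a two-dimensional regular local ring `𝔞♮` has FINITE COLENGTH or is `⊤`
  (`isFiniteLength_quotient_of_forall_not_le`, imported). Traces need NOT be prime or part of a regular system (members need not be transversal to `H₂`,
  RULING -48 (PD)(i)): the split is an honest EXISTENCE statement; its reading as «orders along the member traces» is exact once the traces are snc
  regular parameters (after the snc phase (TL4)(ii)), which is where rows T-L5/T-L6 use it.
* §2 **(s1) `TameLow.CoeffDatum K`** — the datum READ IN `K`: `R : Subring K` regular local of Krull dimension `2` with `IsLocalRingOf R` (exactly the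
  binders of `finite_idealBaseTree_of_isRegularLocalRing`, so row T-L3 is an import), the numerics `m`, `S₀` (`1 ≤ S₀ < m`), the member traces
  (`members : Finset ℕ` — the σ-layer indexes boundary members by `ℕ`, `Sigma.Boundary = List _` / `boundaryMember 𝓑 i` — and `trace : ℕ → R`, non-units),
  and the coefficient ideal `coeff ≠ ⊥`. DERIVED (chosen by §1, `Classical.choose`): `traceOrd` (the exponents `a_i`, `= 0` off `members`; as a `Finsupp`:
  `traceOrdFinsupp`), `monomial` (`𝔪on = ∏ trace_i^{a_i}`; `span_monomial_eq`: `(𝔪on) = ∏ (trace_i)^{a_i}` as ideals), `principalPart` (`g`),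
  `residual` (`𝔞♮`), with the laws `coeff_eq : 𝔞 = (𝔪on)·(g)·𝔞♮`, `principalPart_ne_zero`, `monomial_ne_zero`, `not_trace_dvd_principalPart`,
  `residual_not_le_span_singleton`, `residual_ne_bot`, `residual_eq_top_of_isPrincipal`, `isFiniteLength_quotient_residual`; threshold `c := m * S₀`
  with `c_pos`, `one_lt_m`.
* §3 **(s2) BASE-POINT SOCKET**: `finite_idealBaseTree_residual : (idealBaseTree D.R D.residual).Finite` (Zariski, any residue field — tree theorem),
  `basePointCount D := (idealBaseTree D.R D.residual).ncard` (the FIRST fuel coordinate of RULING -48 (PD)(vi)), and the END-OF-PHASE law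
  **`basePointCount_eq_zero_iff : D.basePointCount = 0 ↔ D.residual = ⊤`** (the base-point phase (TL4)(i) is over iff `𝔞♮ = (1)`: `R` itself is a
  node of the tree unless `𝔞♮ R` is principal, and a principal `𝔞♮` in no proper principal ideal is `⊤`; conversely `⊤` extends to `⊤` everywhere).

VACUITY SELF-CHECK. §1 is a theorem with content (it fails for `𝔞 = 0`, excluded). `CoeffDatum` is inhabited by any two-dimensional regular local ring of
a field with `members = ∅` and `coeff = ⊤` (then `𝔪on = 1`, `𝔞♮ = ⊤` up to the unit `g`, `basePointCount = 0`), and `basePointCount_eq_zero_iff` is not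
trivially true: for `coeff = 𝔪` (no traces) `𝔞♮ = 𝔪 ≠ ⊤` and `R` is a base point. NOT here (FILE 1b / T-L6 / other rows): the s42 row map (s3) onto
`TState.ofPairs`, the fuel triple (s4), the Coeff ↔ `Sing(J,c) ∩ H₂` equivalence and every transform law (hypotheses there), the contact element (T-L1, 060).
-/

noncomputable section

set_option linter.dupNamespace false -- mandated namespace of this single-conjunct summit

open IsLocalRing Literature.AlgebraicGeometry.Resolution

namespace Summit.ResolutionOfSingularities.ResolutionOfSingularities.Theorems.SigmaMaxModificationsCorridor3.Sigma.TameLow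

universe u

/-! ## §1. Lipman factorisation in a Noetherian local domain -/

section Lipman

variable {A : Type u} [CommRing A] [IsDomain A] [IsNoetherianRing A]

/-- **Maximal trace powers, extracted one at a time.** For non-units `u_i` (`i ∈ s`) and `G ≠ 0` in a Noetherian domain:
`G = (∏_{i ∈ s} u_i ^ a_i) · g` with `g ≠ 0`, `u_i ∤ g` for every `i ∈ s`, and `a_i = 0` for `i ∉ s`. [folklore] -/
theorem exists_eq_prod_pow_mul_forall_not_dvd {ι : Type*} [DecidableEq ι] (s : Finset ι) (u : ι → A)
    (hu : ∀ i ∈ s, ¬ IsUnit (u i)) {G : A} (hG : G ≠ 0) :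
    ∃ (a : ι → ℕ) (g : A), G = (∏ i ∈ s, u i ^ a i) * g ∧ g ≠ 0 ∧ (∀ i ∈ s, ¬ u i ∣ g) ∧ ∀ i ∉ s, a i = 0 := by
  induction s using Finset.induction_on with
  | empty => exact ⟨fun _ => 0, G, by simp, hG, by simp, fun _ _ => rfl⟩
  | @insert j s hj ih =>
    obtain ⟨a, g, hGeq, hg0, hndvd, hoff⟩ := ih (fun i hi => hu i (Finset.mem_insert_of_mem hi))
    obtain ⟨n, g', hng', rfl⟩ := WfDvdMonoid.max_power_factor' hg0 (hu j (Finset.mem_insert_self j s))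
    refine ⟨Function.update a j n, g', ?_, right_ne_zero_of_mul hg0, ?_, ?_⟩
    · rw [Finset.prod_insert hj, Function.update_self, hGeq]
      have hprod : ∏ i ∈ s, u i ^ Function.update a j n i = ∏ i ∈ s, u i ^ a i := by
        refine Finset.prod_congr rfl fun i hi => ?_
        rw [Function.update_of_ne (ne_of_mem_of_not_mem hi hj)]
      rw [hprod]
      ring
    · intro i hi
      rcases Finset.mem_insert.mp hi with rfl | hi
      · exact hng'
      · exact fun h => hndvd i hi (h.trans (dvd_mul_left _ _))
    · intro i hi
      rw [Finset.mem_insert, not_or] at hi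
      rw [Function.update_of_ne hi.1, hoff i hi.2]

variable [IsLocalRing A]

/-- **LIPMAN FACTORISATION** (existence): in a Noetherian local domain with non-unit «trace» elements `u_i` (`i ∈ s`), every ideal `𝔞 ≠ 0` is
`𝔞 = (∏ u_i^{a_i}) · (g) · 𝔞♮` with `g ≠ 0`, `u_i ∤ g` (`i ∈ s`), `a_i = 0` off `s`, and `𝔞♮` contained in NO proper principal ideal
`(q)`, `q` a non-unit (in a
two-dimensional regular local ring: `𝔞♮` is `𝔪`-primary or `⊤`, `isFiniteLength_quotient_of_forall_not_le`).
[cite: Lipman1969, Part II §1 p. 51 (P·I, P principal, I 𝔪-primary)] -/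
theorem exists_lipmanFactorisation {ι : Type*} [DecidableEq ι] (s : Finset ι) (u : ι → A) (hu : ∀ i ∈ s, ¬ IsUnit (u i))
    (𝔞 : Ideal A) (h𝔞 : 𝔞 ≠ ⊥) :
    ∃ (a : ι → ℕ) (g : A) (𝔞' : Ideal A),
      𝔞 = Ideal.span {∏ i ∈ s, u i ^ a i} * Ideal.span {g} * 𝔞' ∧ g ≠ 0 ∧ (∀ i ∈ s, ¬ u i ∣ g) ∧ (∀ i ∉ s, a i = 0) ∧
        ∀ q : A, ¬ IsUnit q → ¬ 𝔞' ≤ Ideal.span {q} := by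
  obtain ⟨G, 𝔞', hG0, h𝔞eq, h𝔞'⟩ := exists_eq_span_singleton_mul_forall_not_le 𝔞 h𝔞
  obtain ⟨a, g, hGeq, hg0, hndvd, hoff⟩ := exists_eq_prod_pow_mul_forall_not_dvd s u hu hG0
  refine ⟨a, g, 𝔞', ?_, hg0, hndvd, hoff, fun q hq => h𝔞' q ((mem_maximalIdeal q).mpr hq)⟩
  rw [h𝔞eq, hGeq, ← Ideal.span_singleton_mul_span_singleton]

end Lipman

section Principal

variable {A : Type u} [CommRing A]

/-- An ideal contained in no proper principal ideal `(q)` (`q` a non-unit) that IS principal is `⊤`. [folklore] -/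
theorem eq_top_of_isPrincipal_of_forall_not_le {𝔞' : Ideal A} (h : ∀ q : A, ¬ IsUnit q → ¬ 𝔞' ≤ Ideal.span {q})
    (hp : 𝔞'.IsPrincipal) : 𝔞' = ⊤ := by
  obtain ⟨q, hq⟩ := hp
  have hq' : 𝔞' = Ideal.span {q} := hq
  by_contra hne
  refine h q (fun hu => hne ?_) hq'.le
  rw [hq', Ideal.span_singleton_eq_top]
  exact hu

end Principal

/-! ## §2. (s1) The coefficient-ideal datum on the contact surface germ, read in its fraction field -/

/-- [OURS · L1 W4.2] **(s1) THE TAME-LOW COEFFICIENT DATUM** `Coeff_{H₂}(J)` at a TAME-LOW point, READ IN the fraction field `K` of the surface germ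
(the shape of `Literature…Resolution.idealBaseTree` / `finite_idealBaseTree_of_isRegularLocalRing`): the two-dimensional regular local ring `R = 𝒪_{H₂,x}`
as a subring of `K` with `Frac R = K`, the numerics `m` (order of `I`) and `S₀` (residual order, `1 ≤ S₀ < m`), the boundary members through `x` (indices
in `ℕ`, as the σ-layer's `boundaryMember 𝓑 i`) with the TRACE of each on `H₂` (a non-unit of `R`; not assumed prime or transversal, RULING v3.14-48
(PD)(i)), and the coefficient ideal `𝔞 ≠ 0`. Replaces the role of the «`J₂ = M₂·N₂`» bookkeeping of the classical tame descent in OUR σ-policy; NOT a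
statement of the manuscript. [folklore] -/
structure CoeffDatum (K : Type u) [Field K] where
  /-- the surface germ `𝒪_{H₂,x}` read in `K` -/
  R : Subring K
  /-- it is a regular local ring -/
  isRegularLocalRing : IsRegularLocalRing R
  /-- of Krull dimension two -/
  ringKrullDim_eq_two : ringKrullDim R = 2
  /-- with fraction field `K` -/
  isLocalRingOf : IsLocalRingOf R
  /-- the order `m` of the ideal `I = M·N` on the contact threefold -/
  m : ℕ
  /-- the residual order `S₀ = ord_x N` -/
  S₀ : ℕ
  /-- TAME-LOW: `1 ≤ S₀` -/
  one_le_S₀ : 1 ≤ S₀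
  /-- TAME-LOW: `S₀ < m` -/
  S₀_lt_m : S₀ < m
  /-- the boundary members through `x` (σ-layer member indices) -/
  members : Finset ℕ
  /-- the trace on `H₂` of member `i` (meaningful for `i ∈ members`) -/
  trace : ℕ → R
  /-- traces of members through `x` vanish at `x` (non-units of `R`) -/
  trace_not_isUnit : ∀ i ∈ members, ¬ IsUnit (trace i)
  /-- the coefficient ideal `𝔞 = Coeff_{H₂}(J)` -/
  coeff : Ideal R
  /-- `𝔞 ≠ 0` (`J ≠ 0`) -/
  coeff_ne_bot : coeff ≠ ⊥

namespace CoeffDatum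

variable {K : Type u} [Field K] (D : CoeffDatum K)

/-- [OURS · L1 W4.2] The threshold `c := m · S₀` of `J = I^{S₀} + N^{m}` (SUPPLEMENT (MD′) (TL1)). [folklore] -/
def c : ℕ := D.m * D.S₀

/-- `1 < m` at a TAME-LOW point (`1 ≤ S₀ < m`). [folklore] -/
theorem one_lt_m : 1 < D.m := lt_of_le_of_lt D.one_le_S₀ D.S₀_lt_m

/-- `0 < c = m · S₀` (the input `hc` of s42's `eresolvableAvoiding_ofPairs`; stated unfolded — `D.c` is `D.m * D.S₀` by `rfl`, so this term
is accepted wherever `0 < D.c` is expected). [folklore] -/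
theorem c_pos : 0 < D.m * D.S₀ := Nat.mul_pos (lt_trans Nat.zero_lt_one D.one_lt_m) D.one_le_S₀

/-- `1 < c`: indeed `2 ≤ m` and `1 ≤ S₀`. [folklore] -/
theorem one_lt_c : 1 < D.c := by
  have h := Nat.mul_le_mul D.one_lt_m D.one_le_S₀
  rw [c]
  omega

/-- `c = m · S₀` (`rfl`). [folklore] -/
theorem c_eq : D.c = D.m * D.S₀ := rfl

/-- **The Lipman factorisation of the coefficient ideal EXISTS** (§1 at `R`, traces = the member traces). [cite: Lipman1969, Part II §1 p. 51] -/
theorem exists_factorisation : ∃ (a : ℕ → ℕ) (g : D.R) (𝔞' : Ideal D.R),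
    D.coeff = Ideal.span {∏ i ∈ D.members, D.trace i ^ a i} * Ideal.span {g} * 𝔞' ∧ g ≠ 0 ∧ (∀ i ∈ D.members, ¬ D.trace i ∣ g) ∧
      (∀ i ∉ D.members, a i = 0) ∧ ∀ q : D.R, ¬ IsUnit q → ¬ 𝔞' ≤ Ideal.span {q} := by
  classical
  haveI := D.isRegularLocalRing
  exact exists_lipmanFactorisation D.members D.trace D.trace_not_isUnit D.coeff D.coeff_ne_bot

/-- [OURS · L1 W4.2] **The trace exponents `a_i`** of the factorisation (`𝔪on = ∏ trace_i^{a_i}`; `0` off `members`) — chosen. [folklore] -/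
def traceOrd : ℕ → ℕ := D.exists_factorisation.choose

/-- [OURS · L1 W4.2] **The non-monomial principal part `g`** of the factorisation — chosen. [folklore] -/
def principalPart : D.R := D.exists_factorisation.choose_spec.choose

/-- [OURS · L1 W4.2] **The residual factor `𝔞♮`** (contained in no proper principal ideal; finite colength or `⊤`) — chosen. [folklore] -/
def residual : Ideal D.R := D.exists_factorisation.choose_spec.choose_spec.choose

/-- [OURS · L1 W4.2] **The monomial part `𝔪on = ∏_{i ∈ members} trace_i ^ a_i`**. [folklore] -/
def monomial : D.R := ∏ i ∈ D.members, D.trace i ^ D.traceOrd i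

/-- **`(𝔪on)` IS the product of the member-trace principal ideals to their orders** (the desk's wording of (s1)). [folklore] -/
theorem span_monomial_eq : Ideal.span {D.monomial} = ∏ i ∈ D.members, Ideal.span {D.trace i} ^ D.traceOrd i := by
  rw [monomial, ← Ideal.prod_span_singleton]
  simp_rw [Ideal.span_singleton_pow]

/-- The conjunction of the chosen factorisation's properties. [folklore] -/
theorem factorisation_spec : D.coeff = Ideal.span {∏ i ∈ D.members, D.trace i ^ D.traceOrd i} * Ideal.span {D.principalPart} * D.residual ∧
    D.principalPart ≠ 0 ∧ (∀ i ∈ D.members, ¬ D.trace i ∣ D.principalPart) ∧ (∀ i ∉ D.members, D.traceOrd i = 0) ∧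
      ∀ q : D.R, ¬ IsUnit q → ¬ D.residual ≤ Ideal.span {q} :=
  D.exists_factorisation.choose_spec.choose_spec.choose_spec

/-- **LAW `𝔞 = 𝔪on · (g) · 𝔞♮`.** [cite: Lipman1969, Part II §1 p. 51] -/
theorem coeff_eq : D.coeff = Ideal.span {D.monomial} * Ideal.span {D.principalPart} * D.residual := D.factorisation_spec.1

/-- `g ≠ 0`. [folklore] -/
theorem principalPart_ne_zero : D.principalPart ≠ 0 := D.factorisation_spec.2.1

/-- No member trace divides `g`. [folklore] -/
theorem not_trace_dvd_principalPart {i : ℕ} (hi : i ∈ D.members) : ¬ D.trace i ∣ D.principalPart := D.factorisation_spec.2.2.1 i hi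

/-- `a_i = 0` off `members`. [folklore] -/
theorem traceOrd_eq_zero_of_not_mem {i : ℕ} (hi : i ∉ D.members) : D.traceOrd i = 0 := D.factorisation_spec.2.2.2.1 i hi

/-- [OURS · L1 W4.2] **`𝔪on` as a finitely supported function member ↦ order** (support `⊆ members`). [folklore] -/
def traceOrdFinsupp : ℕ →₀ ℕ :=
  Finsupp.onFinset D.members D.traceOrd fun i hi => by
    by_contra h
    exact hi (D.traceOrd_eq_zero_of_not_mem h)

/-- `traceOrdFinsupp i = traceOrd i`. [folklore] -/
@[simp] theorem traceOrdFinsupp_apply (i : ℕ) : D.traceOrdFinsupp i = D.traceOrd i := Finsupp.onFinset_apply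

/-- The support of `traceOrdFinsupp` lies in `members`. [folklore] -/
theorem traceOrdFinsupp_support_subset : D.traceOrdFinsupp.support ⊆ D.members := Finsupp.support_onFinset_subset

/-- `𝔞♮` lies in no proper principal ideal `(q)`, `q` a non-unit. [folklore] -/
theorem residual_not_le_span_singleton {q : D.R} (hq : ¬ IsUnit q) : ¬ D.residual ≤ Ideal.span {q} := D.factorisation_spec.2.2.2.2 q hq

/-- `𝔞♮ ≠ 0`. [folklore] -/
theorem residual_ne_bot : D.residual ≠ ⊥ := by
  intro h
  apply D.coeff_ne_bot
  rw [D.coeff_eq, h, Ideal.mul_bot]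

/-- `𝔪on ≠ 0`. [folklore] -/
theorem monomial_ne_zero : D.monomial ≠ 0 := by
  intro h
  apply D.coeff_ne_bot
  rw [D.coeff_eq, h, Ideal.span_singleton_eq_bot.mpr rfl, Ideal.bot_mul, Ideal.bot_mul]

/-- **`𝔞♮` has FINITE COLENGTH (or is `⊤`)** — it is `𝔪`-primary, every other prime of the two-dimensional regular local ring being principal.
[cite: Matsumura1987, Thm. 20.3 (dimension two)] -/
theorem isFiniteLength_quotient_residual : IsFiniteLength D.R (D.R ⧸ D.residual) := by
  haveI := D.isRegularLocalRing
  exact isFiniteLength_quotient_of_forall_not_le D.ringKrullDim_eq_two fun q hq =>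
    D.residual_not_le_span_singleton ((mem_maximalIdeal q).mp hq)

/-- `𝔞♮` is principal only when it is `⊤`. [folklore] -/
theorem residual_eq_top_of_isPrincipal (h : D.residual.IsPrincipal) : D.residual = ⊤ :=
  eq_top_of_isPrincipal_of_forall_not_le (fun _ hq => D.residual_not_le_span_singleton hq) h

/-! ## §3. (s2) The base-point socket for row T-L3 -/

/-- **(s2) ZARISKI: the base tree of `𝔞♮` is FINITE** — the iterated quadratic transforms of `R` in which `𝔞♮` is not principal are finitely many
(tree theorem `finite_idealBaseTree_of_isRegularLocalRing`, any residue field; row T-L3 = this import). [cite: ZariskiSamuel1960, Appendix 5] -/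
theorem finite_idealBaseTree_residual : (idealBaseTree D.R D.residual).Finite := by
  haveI := D.isRegularLocalRing
  exact finite_idealBaseTree_of_isRegularLocalRing D.R D.ringKrullDim_eq_two D.isLocalRingOf D.residual

/-- [OURS · L1 W4.2] **(s2) THE BASE-POINT COUNT** `#(idealBaseTree R 𝔞♮)` — the number of (infinitely near) base points of `𝔞♮` still to be blown
up; the FIRST coordinate of the TAME-LOW lineage fuel `ℕ ×ₗ ℕ ×ₗ ℕ` (RULING v3.14-48 (PD)(vi)). Its DROP under the point blow-up of the base-point phase
is a row-T-L6 law, not claimed here. NOT a statement of the manuscript. [folklore] -/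
def basePointCount : ℕ := (idealBaseTree D.R D.residual).ncard

/-- `extIdeal` along the identity is the identity. [folklore] -/
theorem extIdeal_self (J : Ideal D.R) : extIdeal J D.R = J := by
  rw [extIdeal_eq_map J le_rfl]
  have h : Subring.inclusion (le_refl D.R) = RingHom.id D.R := RingHom.ext fun x => Subtype.ext rfl
  rw [h, Ideal.map_id]

/-- `⊤` extends to `⊤`. [folklore] -/
theorem extIdeal_top {S : Subring K} (h : D.R ≤ S) : extIdeal (⊤ : Ideal D.R) S = ⊤ := by
  rw [extIdeal_eq_map ⊤ h, Ideal.map_top]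

/-- `R` itself is a base point of `𝔞♮` unless `𝔞♮ = ⊤`. [folklore] -/
theorem self_mem_idealBaseTree (h : D.residual ≠ ⊤) : D.R ∈ idealBaseTree D.R D.residual := by
  refine ⟨Relation.ReflTransGen.refl, fun hp => h (D.residual_eq_top_of_isPrincipal ?_)⟩
  rwa [D.extIdeal_self] at hp

/-- If `𝔞♮ = ⊤` the base tree is empty. [folklore] -/
theorem idealBaseTree_eq_empty (h : D.residual = ⊤) : idealBaseTree D.R D.residual = ∅ := by
  ext S
  simp only [Set.mem_empty_iff_false, iff_false]
  rintro ⟨hRS, hnp⟩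
  apply hnp
  rw [h, D.extIdeal_top (subringDominates_of_reflTransGen hRS).1]
  exact ⟨⟨1, by simp⟩⟩

/-- **END-OF-PHASE LAW: the base-point phase (TL4)(i) is over iff `𝔞♮ = (1)`** — `basePointCount = 0 ↔ residual = ⊤`. [folklore] -/
theorem basePointCount_eq_zero_iff : D.basePointCount = 0 ↔ D.residual = ⊤ := by
  constructor
  · intro h0
    by_contra hne
    have hempty : idealBaseTree D.R D.residual = ∅ := (Set.ncard_eq_zero D.finite_idealBaseTree_residual).mp h0
    have hmem := D.self_mem_idealBaseTree hne
    rw [hempty] at hmem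
    exact hmem
  · intro h
    rw [basePointCount, D.idealBaseTree_eq_empty h, Set.ncard_empty]

/-- While base points remain, `𝔞♮` is a PROPER ideal of finite colength (the lineage point is a base point). [folklore] -/
theorem residual_ne_top_of_basePointCount_ne_zero (h : D.basePointCount ≠ 0) : D.residual ≠ ⊤ :=
  fun htop => h (D.basePointCount_eq_zero_iff.mpr htop)

end CoeffDatum

end Summit.ResolutionOfSingularities.ResolutionOfSingularities.Theorems.SigmaMaxModificationsCorridor3.Sigma.TameLow

end
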